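import Mathlib
import Summits.Langlands.Langlands.Theses.DyadicOddResidue

/-!
# Engines of the crux-ideate sketch for `DyadicEisensteinFM` (crux stmt-Langlands-18741), kernel-checked

Helper file for the crux `Summit.Langlands.Langlands.Theses.DyadicOddResidue.DyadicEisensteinFM`
(Fontaine–Mazur at `ℓ = 2` for residually reducible odd regular `ρ : Γ_ℚ → GL₂(ℚ̄₂)` — the printed
question of Paškūnas–Tung, Forum Math. Sigma 9 (2021) e80, §1.2).  It lands, unchanged in
statement, the three lemmas PROVED in the ideation sketch `Cruxes/DyadicEisensteinFM/SketchIdeator2.lean`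
(crux-ideate round 1, ideator 2; evidence `Sketch.lean` 2026-08-17T05:42Z) so that later lines can
import them instead of an evidence file:

* `finite_places_above` — the places of `ℚ` above a rational prime form a finite set (turns
  "unramified away from `ℓ`" into "unramified at cofinitely many places"; used by the level-one
  slice of card `koch-free-product-assembly`).
* `nilpotent_of_forall_mem_primes_over` — **density transport** through an integral algebra all of
  whose minimal primes contract to `⊥`: an element lying in every prime above a Zariski-dense set of
  primes of the base is nilpotent (the commutative-algebra engine of card `thorne-dense-weight-two`:
  `Λ = ℤ₂⟦1+4ℤ₂⟧`, `R = R^{ps,n.ord}_S`, `W` = weight-`(2,χ)` primes, `f ∈ ker (R → 𝕋^{n.ord})`).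
* `bijective_of_injective_mod_two` — **mod-2 isomorphisms lift**: a surjection of rings from a
  noetherian ring with `2` in the Jacobson radical onto a `2`-torsion-free ring that is injective
  modulo `2` is bijective (Nakayama; the step "Bellaïche `R̄ ≅ 𝔽₂⟦x,y⟧` ⇒ `R^{ps}_{(2,∞)} ≅ 𝕋₂(1)`"
  of card `koch-free-product-assembly`).

Nothing here closes the crux (an open problem, `[difficulty: open-problem]` on the item); these are
`--supports` helpers.  Statements and proofs are the sketch's, re-homed under
`namespace Summit.Langlands.Langlands.Theorems.DyadicEisensteinFM`.
-/

set_option linter.dupNamespace false -- project-wide option (lakefile weak.linter.dupNamespace); `Summit.Langlands.Langlands` is the mandated namespace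

namespace Summit.Langlands.Langlands.Theorems.DyadicEisensteinFM

open IsDedekindDomain NumberField Filter

/-- The places of `ℚ` above `2` form a finite set (indeed a singleton); used to turn
"unramified away from 2" into "unramified at cofinitely many places". -/
theorem finite_places_above (ℓ : ℕ) [Fact ℓ.Prime] :
    {v : HeightOneSpectrum (𝓞 ℚ) | ((ℓ : ℕ) : 𝓞 ℚ) ∈ v.asIdeal}.Finite := by
  have hne : (Ideal.span {((ℓ : ℕ) : 𝓞 ℚ)} : Ideal (𝓞 ℚ)) ≠ ⊥ := by
    rw [Ne, Ideal.span_singleton_eq_bot]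
    exact_mod_cast (Fact.out : ℓ.Prime).ne_zero
  refine (Ideal.finite_factors hne).subset ?_
  intro v hv
  simp only [Set.mem_setOf_eq] at hv ⊢
  exact (Ideal.dvd_iff_le.mpr ((Ideal.span_singleton_le_iff_mem _).mpr hv))


/-- **Density transport.** `Λ` a domain, `R` an integral `Λ`-algebra all of whose minimal primes
contract to `⊥` (every irreducible component dominates `Spec Λ`), `W` a set of primes of `Λ` that is
Zariski dense (`⋂ W = 0`).  Then an element of `R` lying in every prime of `R` above `W` is
nilpotent.  (Applied to `R = R^{ps,n.ord}_S → 𝕋^{n.ord}`: the kernel dies on the weight-`(2,χ)`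
fibres, which are modular by Thorne 2026 Thm D, hence is nilpotent.) -/
theorem nilpotent_of_forall_mem_primes_over {Λ R : Type*} [CommRing Λ] [IsDomain Λ] [CommRing R]
    [Algebra Λ R] [Algebra.IsIntegral Λ R]
    (hdom : ∀ q ∈ minimalPrimes R, Ideal.comap (algebraMap Λ R) q = ⊥)
    (W : Set (Ideal Λ)) (hWp : ∀ P ∈ W, P.IsPrime) (hW : ∀ c : Λ, (∀ P ∈ W, c ∈ P) → c = 0)
    (f : R) (hf : ∀ 𝔓 : Ideal R, 𝔓.IsPrime → Ideal.comap (algebraMap Λ R) 𝔓 ∈ W → f ∈ 𝔓) :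
    IsNilpotent f := by
  classical
  rw [nilpotent_iff_mem_prime]
  intro p hp
  obtain ⟨q, hqmin, hqp⟩ := Ideal.exists_minimalPrimes_le (show (⊥ : Ideal R) ≤ p from bot_le)
  refine hqp ?_
  haveI hqprime : q.IsPrime := hqmin.1.1
  by_contra hfq
  -- work in the domain `S = R ⧸ q`, integral over `Λ`, into which `Λ` injects
  set S := R ⧸ q with hS
  haveI : Algebra.IsIntegral R S := Algebra.isIntegral_of_surjective Ideal.Quotient.mk_surjective
  haveI : Algebra.IsIntegral Λ S := Algebra.IsIntegral.trans R
  have hcomp : (Ideal.Quotient.mk q).comp (algebraMap Λ R) = algebraMap Λ S := by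
    rw [IsScalarTower.algebraMap_eq Λ R S, Ideal.Quotient.algebraMap_eq]
  set fb : S := Ideal.Quotient.mk q f with hfb
  have hfb0 : fb ≠ 0 := by
    rw [hfb, Ne, Ideal.Quotient.eq_zero_iff_mem]
    exact hfq
  -- a non-zero element of `Λ` inside the ideal `(f̄)`
  have hne : (Ideal.span {fb}).comap (algebraMap Λ S) ≠ ⊥ :=
    Ideal.comap_ne_bot_of_integral_mem hfb0 (Ideal.mem_span_singleton_self fb)
      (Algebra.IsIntegral.isIntegral fb)
  obtain ⟨c, hc, hc0⟩ := Submodule.exists_mem_ne_zero_of_ne_bot hne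
  refine hc0 (hW c fun P hP => ?_)
  haveI : P.IsPrime := hWp P hP
  have hker : RingHom.ker (algebraMap Λ S) ≤ P := by
    intro x hx
    have hx' : x ∈ Ideal.comap (algebraMap Λ R) q := by
      rw [Ideal.mem_comap, ← Ideal.Quotient.eq_zero_iff_mem]
      rw [RingHom.mem_ker, ← hcomp] at hx
      exact hx
    rw [hdom q hqmin, Ideal.mem_bot] at hx'
    rw [hx']
    exact P.zero_mem
  obtain ⟨Q, hQ, hQP⟩ := Ideal.exists_ideal_over_prime_of_isIntegral_of_isDomain P hker
  have hfP : f ∈ Q.comap (Ideal.Quotient.mk q) := by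
    refine hf _ (Ideal.comap_isPrime _ Q) ?_
    rw [Ideal.comap_comap, hcomp, hQP]
    exact hP
  have hfbQ : fb ∈ Q := Ideal.mem_comap.mp hfP
  have hcQ : algebraMap Λ S c ∈ Q := by
    have h1 : algebraMap Λ S c ∈ Ideal.span {fb} := Ideal.mem_comap.mp hc
    exact (Ideal.span_singleton_le_iff_mem Q |>.mpr hfbQ) h1
  have : c ∈ Q.comap (algebraMap Λ S) := Ideal.mem_comap.mpr hcQ
  rwa [hQP] at this


/-- **Mod-2 isomorphisms lift.** A surjective ring map `f : R → T` from a noetherian ring in which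
`2` lies in the Jacobson radical onto a `2`-torsion-free ring, which is injective modulo `2`, is
bijective.  (Nakayama on `ker f`: injectivity mod 2 gives `ker f ⊆ 2R`, torsion-freeness gives
`ker f = 2 · ker f`.)  This is the step `R̄ ≅ A = 𝔽₂⟦x,y⟧` (Bellaïche 2012, Nicolas–Serre 2012)
`⇒ R^{ps}_{(2,∞)} ≅ 𝕋₂(1)`. -/
theorem bijective_of_injective_mod_two {R T : Type*} [CommRing R] [CommRing T] [IsNoetherianRing R]
    (f : R →+* T) (hf : Function.Surjective f) (h2 : (2 : R) ∈ (⊥ : Ideal R).jacobson)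
    (hT : ∀ t : T, 2 * t = 0 → t = 0)
    (hinj : ∀ r : R, f r ∈ Ideal.span {(2 : T)} → r ∈ Ideal.span {(2 : R)}) :
    Function.Bijective f := by
  refine ⟨?_, hf⟩
  rw [RingHom.injective_iff_ker_eq_bot]
  set K : Ideal R := RingHom.ker f with hK
  -- `K ≤ 2 • K`
  have hle : K ≤ Ideal.span {(2 : R)} • K := by
    intro k hk
    have hk0 : f k = 0 := hk
    have h2k : k ∈ Ideal.span {(2 : R)} := hinj k (by rw [hk0]; exact Ideal.zero_mem _)
    obtain ⟨r, hr⟩ := Ideal.mem_span_singleton'.mp h2k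
    have hr0 : f r = 0 := by
      apply hT
      have h1 : f (r * 2) = 0 := by rw [hr]; exact hk0
      rw [map_mul, mul_comm, map_ofNat] at h1
      exact h1
    have hrK : r ∈ K := hr0
    rw [← hr, mul_comm]
    exact Ideal.mul_mem_mul (Ideal.mem_span_singleton_self _) hrK
  have hfg : K.FG := (isNoetherianRing_iff_ideal_fg R).mp ‹_› K
  have hjac : Ideal.span {(2 : R)} ≤ (⊥ : Ideal R).jacobson := by
    rw [Ideal.span_le]; simpa using h2
  exact Submodule.eq_bot_of_le_smul_of_le_jacobson_bot (Ideal.span {(2 : R)}) K hfg hle hjac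


end Summit.Langlands.Langlands.Theorems.DyadicEisensteinFM
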